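import Mathlib
import HarnessLib
import HarnessLib.Audit
import Summits.QuantumFields.Statement

/-!
Route: ConvexGribovBody

DORMANT since 2026-09-05T00:14:06Z (reconciler: no traction for 5 d (last activity statement-checked at 2026-08-30T23:36:16Z); parked, not closed — `ledger route dormant route-QuantumFields-ConvexGribovBody --off` to reactivate) — unstaffed, not closed; items shared with open routes are served there. `ledger route dormant <id> --off` reactivates.

# Route ConvexGribovBody — vacuum Poincaré constant = Coulomb-gauge gluon covariance on the Gribov
body; bounded covariance gives the lattice gap

It suffices to show X = UniformLatticeGap ∧ ContinuumLegGivenGap, with UniformLatticeGap delivered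
in two pieces cut along π₁(G) (route-choice repair 2026-08-16, rev 5). UniformLatticeGap (the card's
deliverable, typed as the rank-0 target): for every compact simple G and faithful unitary lattice
representation r there is β₀ such that for every β ≥ β₀ the Wilson theory has a volume-uniform
lattice mass m(β) > 0 — exponential time-clustering of ALL pairs of gauge-invariant local
observables on all tori (2S+1)⁴ with S ≥ S₁(β), n ≤ S (exactly the `latticeConnectedCorr` shape of
`HasLatticeMassGap`). For SIMPLY-CONNECTED G the card (convex-gribov-body-log-concave-gap) delivers
it as BrascampLiebVacuumSC (per β ≥ β₀(G,r): Poincaré constant of the equal-time vacuum law ≤ C(β) ·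
sup_p D(p), the minimal-Coulomb-gauge equal-time transverse gluon covariance, uniformly in the
volume — the Brascamp–Lieb output of log-concavity on Zwanziger's convex Gribov body) ∧
CovarianceBound (sup_{S,p} D < ∞ at each β ≥ β₀ — the Gribov–Zwanziger horizon suppression) ∧
PoincareToGap (equal-time Poincaré ⇒ transfer-matrix gap ⇒ torus clustering). For G with π₁(G) ≠ 0
(SO(3) = PSU(2), PSU(N), SO(N), …) a volume-uniform slice Poincaré inequality w.r.t. single-link
Dirichlet forms is false modulo the light 't Hooft magnetic-flux sectors of the spatial torus
(landed negative lemma `BrascampLiebVacuum.Negative.brascampLiebVacuum_false_of_sliceBottleneck`, H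
= `Literature.MathematicalPhysics.QuantumFieldTheory.SliceBottleneck`, expected true at SO(3)), so
those groups are carried by the separate item NonSimplyConnectedLatticeGap (the target's restriction
to ¬SimplyConnectedSpace G; natural mechanism: flux-sector decomposition + dilute π₁-monopoles +
sector-blindness of local observables). ContinuumLegGivenGap is the existence leg shared with the
existence cards: given UniformLatticeGap for G, a WEAK-COUPLING sequential scheme (β_k → ∞, a_k ∝
m(β_k)) has a joint continuum limit that is OS data, is Yang–Mills, non-trivial and non-Gaussian in
tr F², and carries the gap. The original rank-2 item BrascampLiebVacuum (∀ compact simple G,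
β-uniform C) stays in the file as a held support item: it is the subject of the landed Negative/
lemmas (FalseOfSliceBottleneck, FalseWithoutLocality, FalseWithoutLipschitz, FalseForFiniteGroups,
DmaxVolumeBound) and is no longer a hypothesis of `closes`.
Lean: `∀ (G : Type) [Group G] [TopologicalSpace G] [IsTopologicalGroup G] [CompactSpace G]
[MeasurableSpace G] [BorelSpace G],
Literature.MathematicalPhysics.QuantumFieldTheory.IsCompactSimpleLieGroup G → ∀ r :
Literature.MathematicalPhysics.QuantumFieldTheory.LatticeRep G, ∃ β₀ : ℝ, ∀ β : ℝ, β₀ ≤ β → ∃ m : ℝ,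
0 < m ∧ ∃ S₁ : ℕ, ∀ A B : Literature.MathematicalPhysics.QuantumFieldTheory.YMSpecies G, ∃ C : ℝ, ∀
S n : ℕ, S₁ ≤ S → n ≤ S → |Literature.MathematicalPhysics.QuantumFieldTheory.latticeConnectedCorr
r.ρ β (2 * S + 1) A.F B.F n| ≤ C * Real.exp (-(m * n))`

## Assembly
Pure logic, proved sorry-free (deciding theorem `closes`, axioms propext, Classical.choice,
Quot.sound): fix compact simple G with its Borel σ-algebra and a faithful r. Case
SimplyConnectedSpace G: BrascampLiebVacuumSC gives β₁ and, for β ≥ β₁, C(β) > 0 and S₀;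
CovarianceBound gives β₂ and, for β ≥ β₂, D(β) > 0 and S₀'; for β ≥ max(β₁, β₂, 1) and S ≥ max(S₀,
S₀') every admissible test function satisfies Var ≤ C·Dmax·dir f ≤ (C·D)·dir f (`ciSup_le` +
positivity of the Dirichlet form), so PoincareToGap with κ = C·D yields m(β) > 0, S₁ and the
clustering bound. Case ¬SimplyConnectedSpace G: NonSimplyConnectedLatticeGap is that bound. Either
way the UniformLatticeGap body holds for every r, and ContinuumLegGivenGap turns it into the
`YangMills` existential for G. UniformLatticeGap (target), StrongCouplingShape (support), the
superseded BrascampLiebVacuum (held support) and the old Assembly item are not antecedents.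

Rationale: WHY THIS LINE. Fix the gauge on each time slice by the absolute minimum of the lattice Coulomb
functional: the physical transfer matrix then lives on the fundamental modular region Λ ⊂ Ω, and in
the continuum Ω = {−∇·D(A) ≥ 0} is bounded and convex (Zwanziger1982, DellantonioZwanziger1991,
Zwanziger1994) while log det(−∇·D(A)) is concave (the FP operator is affine in A), so the equal-time
vacuum law is a density on a convex body whose log-concavity modulus relative to the Gaussian of
covariance D is what dimension-free convex geometry (BrascampLieb1976, Caffarelli2000,
arXiv:1006.1686) converts into a Poincaré constant ≤ ‖D‖_op — imported area: log-concave functional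
inequalities / optimal transport; second import: reversible-Markov-chain spectral comparison
(DiaconisSaloffcoste1993) for the Doob transform of Wilson's transfer matrix
(OsterwalderSeilerAnnPhys1978 §§2–3, Seiler1982 Ch. 2). The single non-perturbative input left is
infrared: the minimal-Coulomb-gauge equal-time gluon covariance is bounded uniformly in the volume
(Gribov1978; horizon scenario arXiv:hep-lat/0209105; lattice: arXiv:0807.3291,
doi:10.1103/physrevd.65.014001), perturbatively false (D ≈ g²/2|p|) and void for U(1) (no horizon).
Every typed item is GAUGE-FIXING-FREE IN ITS HYPOTHESES (test functions are gauge-invariant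
Lipschitz functions of the time-zero spatial links; the gauge enters only through the covariance
scale D, a sup over Coulomb minimisers inside the integral, so no measurable selection is needed)
and lives on large tori only (S ≥ S₀(β): the femto-universe zero modes of Luscher1983 are excluded,
as `HasLatticeMassGap` only asks S ≥ L_k). The only rigorous functional-inequality mass gap for
lattice Yang–Mills (arXiv:2204.12737, Bakry–Émery on the 4d path measure) is confined to strong
coupling |β| < 1/(16(d−1)); this line moves the inequality to the 3d equal-time law, where the
constant is a covariance, not a curvature, and targets β ≥ β₀. ROUTE-CHOICE REPAIR (rev 5,
2026-08-16). The standing disprover and the route reviewer established, kernel-checked, where the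
equal-time Poincaré inequality can and cannot hold: (a) hypotheses (ii) time-zero locality and (iii)
link-Lipschitz are load-bearing and connectedness of G is essential (Negative/FalseWithoutLocality,
FalseWithoutLipschitz, FalseForFiniteGroups); (b) `∃ C` BEFORE `∀ β` is physically dead for SU(N ≥
16) by the trap obstruction (Cruxes/BrascampLiebVacuum/TrapObstruction-ideator1.md; Disproof.lean F3
`ratio_le_of_inner`, repair `BrascampLiebVacuumPerBeta` with `closes_of_perBeta` proved) while
`closes` only ever consumed κ = C·D(β) per β; (c) for π₁(G) ≠ 0 the 't Hooft magnetic-flux sectors m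
∈ H²(T³; π₁G) of the spatial torus are gauge-invariant, time-zero-local, Lipschitz-interpolable
events of non-degenerate Wilson mass whose single-link Dirichlet form is o(S⁻⁶) at every large β
(light magnetic flux: Z₋/Z₊ → 1, F_mg ~ L_z L_t e^{−ρ L_x L_y}, Greensite2011 §4.4 (4.44)–(4.47),
KovacsTomboulis2000, ForcrandSmekal2002, DeforcrandJahn2003 §§4–6, tHooft1979Flux), so with the
landed `dmax_le_volume` (Dmax ≤ 3N(2S+1)³) the rank-2 item is false modulo H = `SliceBottleneck`
(Negative/FalseOfSliceBottleneck `brascampLiebVacuum_false_of_sliceBottleneck`;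
`poincareHypothesis_unsatisfiable_of_sliceBottleneckAt` shows PoincareToGap is vacuous there, so no
restatement of K1 alone can feed `closes` at such G). H is not constructible today — inhabiting it
is a light-magnetic-flux theorem for SO(3)₄, i.e. confinement-strength by Tomboulis–Yaffe (4.46) —
but it is believed, so waiting for H would be waiting for a refutation; and the witness does not
bite simply-connected G with faithful r at β ≥ β₀(G, r) (a non-trivial centre class then costs a
vortex SHEET, mass e^{−cβS²}; the sibling negative
`SusceptibilityToPoincare.Negative.susceptibilityToPoincareSC_false_of_twistInputsSU2` shows that
`SimplyConnectedSpace G` is NOT enough when β is not taken ≥ β₀(G, r): SU(2) with the reducible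
faithful r_k = ρ_{1/2} ⊕ ρ₁^{⊕k} in the Bhanot–Creutz phase-II window — our ∀ r ∃ β₀(G, r) order
dodges it). Hence the choice RESTATE: K1 becomes BrascampLiebVacuumSC (simply-connected G, C after
β), the groups with π₁ ≠ 0 become the separate item NonSimplyConnectedLatticeGap (reviewer's repair
R2), `closes` case-splits on SimplyConnectedSpace G, and the old decl stays rendered as a held
support item because six landed Theorems files name it. Negatives index 2026-08-16: 4 refuted
statements on QuantumFields, none near these items.
RANKED CRUXES. #0 UniformLatticeGap (target) — for every compact simple Lie group G and faithful
unitary lattice representation r there is β₀ with: for all β ≥ β₀ there are m > 0 and S₁ such that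
for all gauge-invariant local observables A, B there is C with |⟨A·τ_n B⟩ − ⟨A⟩⟨B⟩| ≤ C e^{−m n} on
every torus (2S+1)⁴, S ≥ S₁, n ≤ S, under Wilson's measure at coupling β. (why it might fail: it is
the weak-coupling lattice mass gap (Chatterjee's Problem 5.1 without ξ→∞): nothing beyond the
strong-coupling cluster expansion is proved for any non-abelian G in d = 4; a Coulomb phase at large
β would refute it.) [ChatterjeeYMProb2019, OsterwalderSeilerAnnPhys1978, JaffeWitten2000,
arXiv:2204.12737] #2 BrascampLiebVacuumSC (crux; replaces BrascampLiebVacuum as the load-bearing K1)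
— for every SIMPLY-CONNECTED compact simple G and faithful r there is β₀ such that for every β ≥ β₀
there are C = C(G, r, β) > 0 and S₀ with, on all tori S ≥ S₀: for every gauge-invariant function f
of the time-zero spatial links, Lipschitz in the link matrices, Var_μ(f) ≤ C · Dmax(β, S) · Σ_{ℓ
spatial, t=0} ∫ |∇_ℓ f|² dμ (metric slope in link ℓ for the Frobenius metric pulled back by r.ρ; μ
Wilson's measure on (2S+1)⁴; Dmax = sup over spatial momenta p, p = 0 included, of the equal-time
transverse gluon covariance of the minimal lattice Coulomb gauge, sup over absolute minimisers
inside the integral — body verbatim from the old item). The content is VOLUME-UNIFORMITY at fixed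
weak coupling: at fixed (β, S) some constant always exists (smooth positive density on a compact
connected manifold). Intended proof unchanged: relative log-concavity of the vacuum law on the
fundamental modular region w.r.t. the Gaussian of covariance D, Brascamp–Lieb / Caffarelli.
[difficulty: open-problem] (why it might fail: below.) #3 CovarianceBound (crux, unchanged) — for
every compact simple G and r there is β₀ such that for every β ≥ β₀ there are D < ∞ and S₀ with
sup_p of the same covariance ≤ D on every torus S ≥ S₀ — infrared finiteness of the Coulomb-gauge
gluon propagator uniformly in the volume. [difficulty: open-problem] #4 PoincareToGap (crux,
unchanged) — for every compact simple G, r, β > 0, κ > 0, S₀: IF the time-zero law satisfies Var ≤ κ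
· dir f for all admissible f on all tori S ≥ S₀ THEN the UniformLatticeGap body holds at this β
(Doob-transformed transfer matrix, T ≥ 0 by reflection positivity, β^{−1/2}-smoothing, thermal trace
control). Vacuous but harmless at bottleneck groups. [difficulty: L] #5 ContinuumLegGivenGap (crux,
unchanged since rev 4) — for every compact simple G: IF the UniformLatticeGap body holds for every
faithful r THEN there are r, a sequential scheme with β_k → ∞ (`HasWeakCouplingLimit`) and OS data T
with IsYangMillsFor r sch T, T non-trivial and non-Gaussian in tr F², and Δ > 0 with T.HasMassGap Δ
∧ HasLatticeMassGap r sch Δ. [deps: UniformLatticeGap] [difficulty: open-problem] #6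
NonSimplyConnectedLatticeGap (crux, NEW) — the UniformLatticeGap body for compact simple G with
¬SimplyConnectedSpace G and every faithful r: the weak-coupling volume-uniform lattice gap of the
adjoint-type / intermediate-quotient theories (SO(3), PSU(N), SO(N), SU(4)/ℤ₂, …), where the
slice-Poincaré mechanism provably cannot work; natural mechanism: periodic (G, r)-theory = (G̃,
r∘π)-theory = mixture over |H²(T³; π₁G)| light flux sectors up to a dilute gas of π₁-monopoles
(action ≥ c₀β per unit length), per-sector gap + sector-blindness of local observables at rate ≥ m
(flux energies ~ e^{−ρS²}). [difficulty: open-problem] Support: StrongCouplingShape (PROVED,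
strongCouplingShape_proof); BrascampLiebVacuum (the superseded K1, re-badged support, HELD under the
negative lemma; kept rendered for Negative/*.lean and Cruxes/BrascampLiebVacuum/*; never to be
re-filed reworded); Assembly (old frame, PROVED; the deciding theorem is `closes`).
TWO-LAYER PLAN. Foreseen glued splits (k ≤ 3, depth 1; nothing filed now). BrascampLiebVacuumSC ⇐
RelativeLogConcavity (Hess(−log π) ≥ c·D⁻¹ on the lattice FMR in the exponential chart, off a set of
mass e^{−cξ^p} with Holley–Stroock remainder; simply-connected G makes the centre-vortex sheets that
would disconnect the good set cost e^{−cβS²}) → ChartToSlope (flat-chart Brascamp–Lieb/Caffarelli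
Poincaré ⇒ link-metric-slope Poincaré for gauge-invariant f) → BrascampLiebVacuumSC; the registered
line Cruxes/BrascampLiebVacuum/Lines/per_scale_brascamp_lieb.lean (stubs condVarTelescope /
bavgMeasurable / admissibleMemLp landed; uvCascade, crossover, localRelaxation, coarsePoincare open)
composes into the OLD decl and hence, via old ⇒ new (one line: `fun h G … hG _ r => let ⟨C, hC, β₀,
hβ⟩ := h G hG r; ⟨β₀, fun β hb => ⟨C, hC, hβ β hb⟩⟩`), into the new one — but its physics stubs
quantified over all compact simple G with β-uniform constants inherit the SO(3) witness (the lead's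
own SO3-flux-vs-line.md: conditionally on H it kills stub_coarsePoincare) and should be re-cut to
simply-connected G with per-β constants. CovarianceBound ⇐ HorizonConcentration → GribovFormBound →
CovarianceBound. PoincareToGap ⇐ GapFromPoincare → ClusteringFromGap → PoincareToGap.
NonSimplyConnectedLatticeGap ⇐ SectorDecomposition (flux class of the slice off a bad event of mass
S^{−p(β)}; sector weights non-degenerate) → SectorwisePoincareToGap (Poincaré conditioned on the
flux σ-algebra + sector-blindness of local observables ⇒ clustering) — to be typed once the
flux-class notion exists (the T0 construction seat on SliceBottleneck builds it for SO(3)).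
ContinuumLegGivenGap is split by the existence routes, not here.
KILL CRITERIA. ¬CovarianceBound (a proof, or decisive large-volume lattice evidence, that the
minimal-Coulomb-gauge equal-time transverse propagator grows with the volume at some arbitrarily
large β for a simple G) closes the route `refuted:CovarianceBound`. ¬BrascampLiebVacuumSC by an
admissible family f_S at a SIMPLY-CONNECTED G and fixed β ≥ β₀(G, r) with Var/dir growing in S (a
slice bottleneck without topological sectors — phase coexistence or a protected slow mode at weak
coupling) kills the equal-time Poincaré programme: close, unless the offending mode has a
volume-bounded covariance that can replace Dmax (restate once, not twice). A construction of H =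
SliceBottleneck refutes only the held support item BrascampLiebVacuum (drop it then; the route is
unaffected). ¬NonSimplyConnectedLatticeGap (no volume-uniform gap for some SO(3)-type Wilson theory
at arbitrarily large β) refutes the TARGET and the summit's HasLatticeMassGap clause for that G —
every lattice-gap route dies with it. ¬PoincareToGap (equal-time Poincaré holding while the
transfer-matrix gap closes): close. UniformLatticeGap proved by any other route moots K1–K3 and #6
(the route collapses to the shared Leg).
NOT DECOMPOSED YET. Deliberately left for layer 2: the gauge-fixed machinery (a.s. uniqueness mod
global G of the minimal Coulomb gauge, lattice Faddeev–Popov operator and FMR geometry — convexity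
only for ‖A‖ ≪ 1 on the lattice, concavity of log det), the size of C(β) (expected O(1)·N for
moderate N; the trap obstruction forces C(β)·Dmax ≥ e^{(2−12π²/N)β} for SU(N ≥ 60), which per-β
constants absorb), the quantitative rate m ≥ c/(βκ) in PoincareToGap (kept out of the Lean on
purpose), the zero-mode/toron sector (excluded by S ≥ S₀(β); Luscher1983), the free-field and U(1)
calibrations of the card, the k-uniform prefactors / E0–E4 of the Leg, and the whole mechanism of #6
(sector decomposition; a unified sector-conditioned K1 for all G, `E Var(f | flux class) ≤
C·Dmax·dir f`, is the reviewer's repair R1 and would re-merge #2 and #6 once the flux class is a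
tree notion).
CHEAPEST FALSIFIER. Desk check first: run the chain on the free massive lattice field (κ = max_p
g²/(2ω̂_p), gap = 1 − e^{−m}) — done in the card, consistent. Data check second: the
minimal-Coulomb-gauge equal-time transverse propagator of SU(2) in 3+1 is measured volume-stable and
infrared-suppressed (Gribov form, M ≈ 0.88 GeV, arXiv:0807.3291; doi:10.1103/physrevd.65.014001); a
newer large-volume study showing D(p_min) ∝ volume would kill CovarianceBound at once. For #2
specifically: exhibit, for SU(2) fundamental at one fixed large β, ANY gauge-invariant
time-zero-local Lipschitz family with Var/dir ≫ S³ (then `dmax_le_volume` finishes the refutation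
exactly as in FalseOfSliceBottleneck) — the disprover's F0 search found none once topological
sectors are priced at e^{−cβS²}. For #6: a Monte-Carlo signal that local glueball correlators of
periodic SO(3) lattice gauge theory fail to cluster uniformly in the volume at large β_A
(DeforcrandJahn2003 found SU(2)-like glueballs within each twist sector).
NUMBERS. Gribov-form fit of the SU(2) Coulomb-gauge static transverse propagator: M = 0.88(1) GeV
(arXiv:0807.3291). Rigorous functional-inequality gap so far: |β| < 1/(16(d−1)) = 1/48 in d = 4
(arXiv:2204.12737 Thm 1.2 + Cor.). Strong coupling: m(β) ≥ −4 log(Cβ) (OsterwalderSeilerAnnPhys1978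
Thm 3.5). Expected weak-coupling scales (lattice units): local test functions Var/dir ≍ 1/β; soft
magnetic modes ≍ Nξ/β = the Dmax scale; K3 rate ≍ 1/ξ. A-priori bound Dmax ≤ 3N(2S+1)³
(dmax_le_volume). Flux sectors: |H²(T³; ℤ₂)| = 8 for SO(3); magnetic free energy F_mg ~ L² e^{−ρL²}
in the confined phase (Greensite2011 (4.47)); vortex sheet cost for simply-connected G and faithful
r ≥ c(r)βS². Items after rev 5: 9 (1 target, 5 cruxes, 2 support incl. the held old K1, 1 assembly);
`closes` uses 5.
DEFINITION REQUESTS. None needed for elaboration: all items are typed inline over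
ConstructiveQFTWave0 / YangMillsOS vocabulary (GaugeConfig, gaugeTransform, IsGaugeInvariant,
wilsonMeasure, LatticeRep, YMSpecies, latticeConnectedCorr, IsYangMillsFor, HasLatticeMassGap,
OSData) plus Mathlib's `SimplyConnectedSpace`. Wanted for layer 2 (topic
Literature/MathematicalPhysics/QuantumFieldTheory): minimal lattice Coulomb functional and its
argmin set; equal-time transverse gluon covariance D(p); link metric slope / equal-time Dirichlet
form; lattice Faddeev–Popov operator and fundamental modular region; and, for #6 / repair R1, the
coarse-grained magnetic flux class H²(T³; π₁G) of a slice configuration off its bad event (being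
built for SO(3) by the SliceBottleneck construction seat). Cone facts (route-repair 2026-08-15,
unchanged): the five unproved named facts in the module cone (CaoParkSheffieldProblem;
isSpecification_ymSpecification — refuted as stated, Hausdorff twin proved; ClayYangMillsEuclidean,
ClayYangMillsEuclideanGap, ClayYangMillsEuclideanAlong — [status: open] renderings of the Clay
problem) all sit in the mandatory import chain of Summits.QuantumFields.YangMills.Statement and none
is used by any item or by `closes` (constant-level cone: 0 unproved named facts); needs-fact: none.

Novelty: Searches (2026-08-15): `lit galaxy search "fundamental modular region" --star all` (18 rows: Huber
thesis, Greensite–Olejník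
PRD 69 074506, Zwanziger hep-ph/0303028, Dudal et al. 0806.4348 — Gribov–Zwanziger physics, nothing
rigorous or
convex-geometric); `lit galaxy search "Gribov region convex Brascamp-Lieb" --star all` and
`"Poincare inequality Coulomb gauge
Yang-Mills mass gap" --star all` (0 rows each); `lit search "log-Sobolev Poincare inequality lattice
Yang-Mills mass gap
Bakry-Emery"` (held: arXiv:2204.12737, arXiv:2401.13299; remote: noise); `lit search "Gribov horizon
Coulomb gauge gluon
propagator infrared lattice Zwanziger"` (12 held GZ-scenario papers incl. arXiv:1201.4590,
arXiv:1106.0691, hep-ph/0303028;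
crossref: doi:10.1103/physrevd.65.014001, doi:10.1103/physrevlett.102.032002,
doi:10.1103/physrevd.77.071501); `lit frontier
QuantumFields --since 2021` (30 rows, none on Coulomb gauge / Gribov / log-concavity); `ledger
negatives --problem
QuantumFields` (0); the card's own reads of hep-lat/0209105, 1102.3941, 0807.3291. OpenAlex/S2 were
rate-limited (HTTP 429)
and searchd timed out twice (rc 75) — recorded.
Nearest prior art found: the Gribov–Zwanziger scenario itself (Gribov1978, Zwanziger1982,
DellantonioZwanziger1989,
DellantonioZwanziger1991, Zwanziger1994, arXiv:hep-lat/0209105: convex bounded Ω/Λ, concave log det,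
horizon ⇒ infrared
suppression — physics-level, self-consistent); Shen–Zhu–Zhu arXiv:2204.12737 (the only rigorous
'functional inequality ⇒
l  [refs: 10.1103/physrevd.65.014001, 10.1103/physrevlett.102.032002, 10.1103/physrevd.77.071501, 2204.12737, 2401.13299, 1201.4590, 1106.0691, hep-lat/0209105, hep-th/9804132, 1006.1686, doi:10.1103/physrevd.65.014001, doi:10.1103/physrevlett.102.032002, doi:10.1103/physrevd.77.071501, Gribov1978, Zwanziger1982, DellantonioZwanziger1989, DellantonioZwanziger1991, Zwanziger1994, BrascampLieb1976, Caffarelli]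

Barriers (technique_class: log-concavity-on-gribov-region, coulomb-gauge): - technique_class: log-concavity-on-gribov-region, coulomb-gauge
- Literature.Barriers.QuantumFields.NeubergerZeroOverZero: evaded — no BRST/Faddeev–Popov insertion
and no signed sum over Gribov copies: the gauge enters only through absolute minimisers of the
Coulomb functional (a sup over the argmin set inside an integral of a non-negative quantity), so no
0/0.
- Literature.Barriers.QuantumFields.ElitzurTheorem: not in class — no gauge-variant order parameter
or symmetry breaking is asserted; every test function and observable in the items is
gauge-invariant; D(p) is a conditional (gauge-fixed) covariance used only as a scale.
- Literature.Barriers.QuantumFields.OehmeZimmermannSuperconvergence: not in class — no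
Källén–Lehmann positivity of a gluon propagator is used; D is a Euclidean equal-time covariance and
the output is clustering of gauge-invariant observables.
- Literature.Barriers.QuantumFields.AbelianDeconfinementD4: evaded structurally and by hypothesis —
all items assume IsCompactSimpleLieGroup; for U(1) the FP operator is field-independent, there is no
horizon and D(p_min) ∝ S, so CovarianceBound is false exactly where the Coulomb phase lives; the
chain is not group-blind (its GroupBlindClusteringD4 form stops at K2) and cannot 'prove' a U(1)₄
gap.
- Literature.Barriers.QuantumFields.ZnHiggsPhaseD4: respected by hypothesis (discrete-subgroup
freezing) — for finite G the link metric slope is void and BrascampLiebVacuum would be false;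
IsCompactSimpleLieGroup (conne

History (route lifecycle, newest last):
- 2026-08-16T17:36:02Z · rev 4: restated ContinuumLegGivenGap (stmt-QuantumFields-8782) — route-repair (statement-revised p116790): YangMills gained the conjunct sch.HasWeakCouplingLimit. This route supplies it INSIDE the existence leg's witness: Con (planner-rrepair-QuantumFields-ConvexGribovBody-3a812462-0)
- 2026-08-25T11:51:32Z · DORMANT — reconciler: no traction for 7.7 d (last activity item-evidence-added at 2026-08-17T19:14:14Z); parked, not closed — `ledger route dormant route-QuantumFields-Co (operator:999:1465773)
- 2026-08-29T10:40:36Z · REACTIVATED — reconciler: reactivated — activity statement-checked at 2026-08-29T09:14:05Z after parking at 2026-08-25T11:51:32Z (operator:999:3052620)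
- 2026-09-05T00:14:06Z · DORMANT — reconciler: no traction for 5 d (last activity statement-checked at 2026-08-30T23:36:16Z); parked, not closed — `ledger route dormant route-QuantumFields-Convex (operator:999:524019)

sub-problem: YangMills · status: dormant · opened planner-plancard-QuantumFields-YangMills-conv-6afa11db-0 2026-08-15T13:32:33Z · rev 6 · ledger route-QuantumFields-ConvexGribovBody
GENERATED by the gate from the ledger (D-0016/17). Provers cite these decls: `theorem foo : Summit.QuantumFields.YangMills.Theses.ConvexGribovBody.<Decl> := …` in Summits/QuantumFields/YangMills/Theorems/<Name>.lean.
-/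

namespace Summit.QuantumFields.YangMills.Theses.ConvexGribovBody

open scoped BigOperators Topology Manifold Classical MeasureTheory ProbabilityTheory Matrix InnerProductSpace ComplexConjugate ContinuousMap
open Filter Set Function TopologicalSpace MeasureTheory

attribute [summit_statement] _root_.YangMills

/-- item stmt-QuantumFields-8778 · target · rank 0 · open · by planner
why it might fail: It is the weak-coupling lattice mass gap (Chatterjee Problem 5.1 minus ξ→∞; tree conjecture LatticeMassGapAllCouplings): for non-abelian G in d=4 nothing is proved beyond strong coupling (OS1978 cluster expansion; SZZ 2204.12737 |β|<1/(16(d−1))); a Coulomb/massless phase at some large β refutes it.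
sources: ChatterjeeYMProb2019, Literature.MathematicalPhysics.QuantumFieldTheory.LatticeMassGapAllCouplings, OsterwalderSeilerAnnPhys1978, ShenZhuZhu2022, JaffeWitten2000
[target] for every compact simple Lie group G and faithful unitary lattice representation r there is
β₀ with: for all β ≥ β₀ there are m > 0 and S₁ such that for all gauge-invariant local observables
A, B there is C with |⟨A·τ_n B⟩ − ⟨A⟩⟨B⟩| ≤ C e^{−m n} on every torus (2S+1)⁴, S ≥ S₁, n ≤ S, under
Wilson's measure at coupling β (volume-uniform weak-coupling lattice mass gap; the
`latticeConnectedCorr` shape of `HasLatticeMassGap` at fixed β). -/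
@[route_item "route-QuantumFields-ConvexGribovBody"]
def UniformLatticeGap : Prop :=
  ∀ (G : Type) [Group G] [TopologicalSpace G] [IsTopologicalGroup G] [CompactSpace G] [MeasurableSpace G] [BorelSpace G], Literature.MathematicalPhysics.QuantumFieldTheory.IsCompactSimpleLieGroup G → ∀ r : Literature.MathematicalPhysics.QuantumFieldTheory.LatticeRep G, ∃ β₀ : ℝ, ∀ β : ℝ, β₀ ≤ β → ∃ m : ℝ, 0 < m ∧ ∃ S₁ : ℕ, ∀ A B : Literature.MathematicalPhysics.QuantumFieldTheory.YMSpecies G, ∃ C : ℝ, ∀ S n : ℕ, S₁ ≤ S → n ≤ S → |Literature.MathematicalPhysics.QuantumFieldTheory.latticeConnectedCorr r.ρ β (2 * S + 1) A.F B.F n| ≤ C * Real.exp (-(m * n))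

/-- item stmt-QuantumFields-16404 · crux · rank 2 · open · by planner
why it might fail: Needs Hess(−log π) ≥ c(β)·D⁻¹ on the lattice FMR uniformly in S: Gribov copies inside Λ, the non-convex magnetic term, or any slow gauge-invariant slice mode at fixed weak coupling not priced by the faithful r (phase coexistence, a protected sector) with Var/dir ≫ S³ kills it via dmax_le_volume.
sources: BrascampLieb1976, Caffarelli2000, arXiv:1006.1686, Zwanziger1994, DellantonioZwanziger1991, Zwanziger1982
[crux] (K1 restated 2026-08-16, route-choice repair; replaces BrascampLiebVacuum as the load-bearing
item) for every SIMPLY-CONNECTED compact simple G (IsCompactSimpleLieGroup G ∧ SimplyConnectedSpace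
G) and every faithful unitary lattice representation r there is β₀ such that for every β ≥ β₀ there
are C = C(G, r, β) > 0 and S₀ with, on every torus (2S+1)⁴ with S ≥ S₀: for every gauge-invariant
function f of the time-zero spatial links, Lipschitz in the link matrices, Var_μ(f) ≤ C · Dmax(β, S)
· Σ_{ℓ spatial, t=0} ∫ |∇_ℓ f|² dμ, where |∇_ℓ f| is the metric slope in link ℓ (Frobenius metric
pulled back by r.ρ), μ is Wilson's measure and Dmax = sup over spatial momenta p (p = 0 included) of
the equal-time transverse gluon covariance of the minimal lattice Coulomb gauge (sup over absolute
minimisers inside the integral) — body verbatim from BrascampLiebVacuum; two changes: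
`SimplyConnectedSpace G →` (the 't Hooft flux sectors of π₁(G) ≠ 0 make the old ∀-G statement false
modulo Literature.MathematicalPhysics.QuantumFieldTheory.SliceBottleneck:
Negative/FalseOfSliceBottleneck) and `∃ C` after `∀ β ≥ β₀` (disprover F3, trap obstruction; closes
consumes κ = C·D(β) per β). Content = volu -/
@[route_item "route-QuantumFields-ConvexGribovBody"]
def BrascampLiebVacuumSC : Prop :=
  ∀ (G : Type) [Group G] [TopologicalSpace G] [IsTopologicalGroup G] [CompactSpace G] [MeasurableSpace G] [BorelSpace G], Literature.MathematicalPhysics.QuantumFieldTheory.IsCompactSimpleLieGroup G → SimplyConnectedSpace G → ∀ r : Literature.MathematicalPhysics.QuantumFieldTheory.LatticeRep G, ∃ β₀ : ℝ, ∀ β : ℝ, β₀ ≤ β → ∃ C : ℝ, 0 < C ∧ ∃ S₀ : ℕ, ∀ S : ℕ, S₀ ≤ S → let μ := Literature.MathematicalPhysics.QuantumFieldTheory.wilsonMeasure (d := 4) (L := 2 * S + 1) r.ρ β; let fro : Matrix (Fin r.N) (Fin r.N) ℂ → ℝ := fun M => ∑ a, ∑ b, ‖M a b‖ ^ 2; let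 coul : Literature.MathematicalPhysics.QuantumFieldTheory.GaugeConfig 4 (2 * S + 1) G → (Literature.MathematicalPhysics.QuantumFieldTheory.Site 4 (2 * S + 1) → G) → ℝ := fun U h => -∑ e : Literature.MathematicalPhysics.QuantumFieldTheory.Edge 4 (2 * S + 1), (if e.1 0 = 0 ∧ e.2 ≠ 0 then (r.ρ (Literature.MathematicalPhysics.QuantumFieldTheory.gaugeTransform h U e)).trace.re else 0); let cov : Literature.MathematicalPhysics.QuantumFieldTheory.GaugeConfig 4 (2 * S + 1) G → (Literature.MathematicalPhysics.QuantumFieldTheory.Site 4 (2 * S + 1) → G) → (Fin 3 → ZMod (2 * S + 1)) → ℝ := fun U h p => (∑ j : Fin 3, fro (∑ y : Fin 3 → ZMod (2 * S + 1), Complex.exp (-(2 * Real.pi * Complex.I * (∑ i : Fin 3, ((p i).val : ℂ) * ((y i).val : ℂ)) / (2 * S + 1 : ℂ))) • ((1 / 2 : ℂ) • (r.ρ (Literature.MathematicalPhysics.QuantumFieldTheory.gaugeTransform h U (Fin.cons (0 : ZMod (2 * S + 1)) y, j.succ)) - (r.ρ (Literature.MathematicalPhysics.QuantumFieldTheory.gaugeTransform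 h U (Fin.cons (0 : ZMod (2 * S + 1)) y, j.succ)))ᴴ)))) / ((2 * S + 1 : ℝ) ^ 3); let Dmax : ℝ := ⨆ p : Fin 3 → ZMod (2 * S + 1), ∫ U, (⨆ h : {h : Literature.MathematicalPhysics.QuantumFieldTheory.Site 4 (2 * S + 1) → G // ∀ h', coul U h ≤ coul U h'}, cov U h.1 p) ∂μ; let slope : (Literature.MathematicalPhysics.QuantumFieldTheory.GaugeConfig 4 (2 * S + 1) G → ℝ) → Literature.MathematicalPhysics.QuantumFieldTheory.GaugeConfig 4 (2 * S + 1) G → Literature.MathematicalPhysics.QuantumFieldTheory.Edge 4 (2 * S + 1) → ℝ := fun f U e => Filter.limsup (fun g : G => |f (Function.update U e g) - f U| / Real.sqrt (fro (r.ρ g - r.ρ (U e)))) (𝓝[≠] (U e)); let dir : (Literature.MathematicalPhysics.QuantumFieldTheory.GaugeConfig 4 (2 * S + 1) G → ℝ) → ℝ := fun f => ∑ e : Literature.MathematicalPhysics.QuantumFieldTheory.Edge 4 (2 * S + 1), (if e.1 0 = 0 ∧ e.2 ≠ 0 then ∫ U, (slope f U e) ^ 2 ∂μ else 0); ∀ f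 : Literature.MathematicalPhysics.QuantumFieldTheory.GaugeConfig 4 (2 * S + 1) G → ℝ, Literature.MathematicalPhysics.QuantumFieldTheory.IsGaugeInvariant f → (∀ U V : Literature.MathematicalPhysics.QuantumFieldTheory.GaugeConfig 4 (2 * S + 1) G, (∀ e : Literature.MathematicalPhysics.QuantumFieldTheory.Edge 4 (2 * S + 1), e.1 0 = 0 → e.2 ≠ 0 → U e = V e) → f U = f V) → (∃ K : ℝ, ∀ U V : Literature.MathematicalPhysics.QuantumFieldTheory.GaugeConfig 4 (2 * S + 1) G, |f U - f V| ≤ K * ∑ e, Real.sqrt (fro (r.ρ (U e) - r.ρ (V e)))) → ∫ U, (f U - ∫ V, f V ∂μ) ^ 2 ∂μ ≤ C * Dmax * dir f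

/-- item stmt-QuantumFields-8780 · crux · rank 3 · open · by planner
why it might fail: Volume-uniform sup_p D(p)<∞ is infrared non-perturbative (perturbatively D(p_min)≈g²/2p_min ∝ S): GZ horizon dominance is self-consistent only, the ellipsoidal bound gives just D=o(1/p), lattice IR data were contradictory pre-0807.3291, and a gauge-invariant gap does not imply it (A^Coul non-local).
sources: Gribov1978, Zwanziger1982, DellantonioZwanziger1989, Zwanziger1994, arXiv:hep-lat/0209105, arXiv:0807.3291
[crux] (card K2) for every compact simple G and r there is β₀ such that for every β ≥ β₀ there are D
< ∞ and S₀ with: on every torus (2S+1)⁴, S ≥ S₀, and for every spatial momentum p (p = 0 included),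
the equal-time transverse gluon covariance of the minimal lattice Coulomb gauge (same expression as
in BrascampLiebVacuum) is ≤ D — infrared finiteness of the Coulomb-gauge gluon propagator uniformly
in the volume (Gribov form D(p) = (g²/2)|p|/√(p⁴+M⁴) even vanishes at p → 0; the massive free value
would be g²/2m). [difficulty: open-problem] -/
@[route_item "route-QuantumFields-ConvexGribovBody"]
def CovarianceBound : Prop :=
  ∀ (G : Type) [Group G] [TopologicalSpace G] [IsTopologicalGroup G] [CompactSpace G] [MeasurableSpace G] [BorelSpace G], Literature.MathematicalPhysics.QuantumFieldTheory.IsCompactSimpleLieGroup G → ∀ r : Literature.MathematicalPhysics.QuantumFieldTheory.LatticeRep G, ∃ β₀ : ℝ, ∀ β : ℝ, β₀ ≤ β → ∃ D : ℝ, 0 < D ∧ ∃ S₀ : ℕ, ∀ S : ℕ, S₀ ≤ S → let μ := Literature.MathematicalPhysics.QuantumFieldTheory.wilsonMeasure (d := 4) (L := 2 * S + 1) r.ρ β; let fro : Matrix (Fin r.N) (Fin r.N) ℂ → ℝ := fun M => ∑ a, ∑ b, ‖M a b‖ ^ 2; let coul : Literature.MathematicalPhysics.QuantumFieldTheory.GaugeConfig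 4 (2 * S + 1) G → (Literature.MathematicalPhysics.QuantumFieldTheory.Site 4 (2 * S + 1) → G) → ℝ := fun U h => -∑ e : Literature.MathematicalPhysics.QuantumFieldTheory.Edge 4 (2 * S + 1), (if e.1 0 = 0 ∧ e.2 ≠ 0 then (r.ρ (Literature.MathematicalPhysics.QuantumFieldTheory.gaugeTransform h U e)).trace.re else 0); let cov : Literature.MathematicalPhysics.QuantumFieldTheory.GaugeConfig 4 (2 * S + 1) G → (Literature.MathematicalPhysics.QuantumFieldTheory.Site 4 (2 * S + 1) → G) → (Fin 3 → ZMod (2 * S + 1)) → ℝ := fun U h p => (∑ j : Fin 3, fro (∑ y : Fin 3 → ZMod (2 * S + 1), Complex.exp (-(2 * Real.pi * Complex.I * (∑ i : Fin 3, ((p i).val : ℂ) * ((y i).val : ℂ)) / (2 * S + 1 : ℂ))) • ((1 / 2 : ℂ) • (r.ρ (Literature.MathematicalPhysics.QuantumFieldTheory.gaugeTransform h U (Fin.cons (0 : ZMod (2 * S + 1)) y, j.succ)) - (r.ρ (Literature.MathematicalPhysics.QuantumFieldTheory.gaugeTransform h U (Fin.cons (0 : ZMod (2 * S + 1)) y,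 j.succ)))ᴴ)))) / ((2 * S + 1 : ℝ) ^ 3); ∀ p : Fin 3 → ZMod (2 * S + 1), ∫ U, (⨆ h : {h : Literature.MathematicalPhysics.QuantumFieldTheory.Site 4 (2 * S + 1) → G // ∀ h', coul U h ≤ coul U h'}, cov U h.1 p) ∂μ ≤ D

/-- item stmt-QuantumFields-8781 · crux · rank 4 · open · by planner
why it might fail: μ-Poincaré bounds the gap of T only via a Dirichlet-form comparison E_T̂(g) ≥ (c/β)·dir(g) with volume-free c although one step moves all 3(2S+1)³ links (Doob-drift cross terms), plus Holley–Stroock control of the period-(2S+1) thermal law vs Ω² (gap bootstrap); SZZ's 4d Poincaré⇒gap needs |β|<1/48.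
sources: OsterwalderSeilerAnnPhys1978, Seiler1982, DiaconisSaloffcoste1993, Luscher1983, ShenZhuZhu2022, arXiv:2401.13299
[crux] (card K3, Markov-to-spectral transfer, typed without the rate) for every compact simple G, r,
β > 0, κ > 0 and S₀: IF on every torus (2S+1)⁴ with S ≥ S₀ the time-zero law satisfies the Poincaré
inequality Var_μ(f) ≤ κ Σ_{ℓ spatial, t=0} ∫|∇_ℓ f|² dμ for all gauge-invariant link-Lipschitz
functions f of the time-zero spatial links, THEN there are m > 0 and S₁ such that all pairs of
gauge-invariant local observables cluster in time at rate m on all tori S ≥ S₁, n ≤ S (the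
UniformLatticeGap body at this β). Intended proof: Doob transform of the physical transfer matrix (T
≥ 0 by reflection positivity) is a reversible Markov operator for the vacuum law whose one-step
kernel diffuses each link at scale β^{−1/2}, so gap ≥ c/(βκ) (free massive field: equality up to
constants), then spectral gap ⇒ torus clustering with thermal corrections for period 2S+1.
[difficulty: L] -/
@[route_item "route-QuantumFields-ConvexGribovBody"]
def PoincareToGap : Prop :=
  ∀ (G : Type) [Group G] [TopologicalSpace G] [IsTopologicalGroup G] [CompactSpace G] [MeasurableSpace G] [BorelSpace G], Literature.MathematicalPhysics.QuantumFieldTheory.IsCompactSimpleLieGroup G → ∀ r : Literature.MathematicalPhysics.QuantumFieldTheory.LatticeRep G, ∀ β : ℝ, 0 < β → ∀ κ : ℝ, 0 < κ → ∀ S₀ : ℕ, (∀ S : ℕ, S₀ ≤ S → let μ := Literature.MathematicalPhysics.QuantumFieldTheory.wilsonMeasure (d := 4) (L := 2 * S + 1) r.ρ β; let fro : Matrix (Fin r.N) (Fin r.N) ℂ → ℝ := fun M => ∑ a, ∑ b, ‖M a b‖ ^ 2; let slope : (Literature.MathematicalPhysics.QuantumFieldTheory.GaugeConfig 4 (2 *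 S + 1) G → ℝ) → Literature.MathematicalPhysics.QuantumFieldTheory.GaugeConfig 4 (2 * S + 1) G → Literature.MathematicalPhysics.QuantumFieldTheory.Edge 4 (2 * S + 1) → ℝ := fun f U e => Filter.limsup (fun g : G => |f (Function.update U e g) - f U| / Real.sqrt (fro (r.ρ g - r.ρ (U e)))) (𝓝[≠] (U e)); let dir : (Literature.MathematicalPhysics.QuantumFieldTheory.GaugeConfig 4 (2 * S + 1) G → ℝ) → ℝ := fun f => ∑ e : Literature.MathematicalPhysics.QuantumFieldTheory.Edge 4 (2 * S + 1), (if e.1 0 = 0 ∧ e.2 ≠ 0 then ∫ U, (slope f U e) ^ 2 ∂μ else 0); ∀ f : Literature.MathematicalPhysics.QuantumFieldTheory.GaugeConfig 4 (2 * S + 1) G → ℝ, Literature.MathematicalPhysics.QuantumFieldTheory.IsGaugeInvariant f → (∀ U V : Literature.MathematicalPhysics.QuantumFieldTheory.GaugeConfig 4 (2 * S + 1) G, (∀ e : Literature.MathematicalPhysics.QuantumFieldTheory.Edge 4 (2 * S + 1), e.1 0 = 0 → e.2 ≠ 0 → U e = V e) → f U = f V) → (∃ K : ℝ, ∀ U V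 : Literature.MathematicalPhysics.QuantumFieldTheory.GaugeConfig 4 (2 * S + 1) G, |f U - f V| ≤ K * ∑ e, Real.sqrt (fro (r.ρ (U e) - r.ρ (V e)))) → ∫ U, (f U - ∫ V, f V ∂μ) ^ 2 ∂μ ≤ κ * dir f) → ∃ m : ℝ, 0 < m ∧ ∃ S₁ : ℕ, ∀ A B : Literature.MathematicalPhysics.QuantumFieldTheory.YMSpecies G, ∃ C : ℝ, ∀ S n : ℕ, S₁ ≤ S → n ≤ S → |Literature.MathematicalPhysics.QuantumFieldTheory.latticeConnectedCorr r.ρ β (2 * S + 1) A.F B.F n| ≤ C * Real.exp (-(m * n))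

-- earlier ContinuumLegGivenGap (stmt-QuantumFields-8782, replaced 2026-08-16T17:36:02Z -> stmt-QuantumFields-15828): moot by None — ∀ (G : Type) [Group G] [TopologicalSpace G] [IsTopologicalGroup G] [CompactSpace G], Literature.MathematicalPhysics.QuantumFieldTheory.IsCompactSimpleLieGroup G → letI : MeasurableSpace G := borel G; haveI : BorelSpace G := ⟨rfl⟩; (∀ r : Literature.MathematicalPhysics.Q
/-- item stmt-QuantumFields-15828 · crux · rank 5 · open · by operator
why it might fail: Existence half of the problem: E0–E4 + IsYangMillsFor for ALL species lie beyond Balaban's UV stability (no OS axioms/uniqueness/rotations); now pinned to β_k→∞: if ξ(β) stays bounded as β→∞ every weak-coupling a_k→0 limit is ultralocal ⇒ Gaussian — the gap hypothesis may hold, IsNonGaussian fail.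
sources: JaffeWitten2000, Balaban1989LargeFieldII, Literature.Barriers.QuantumFields.UVStabilityNonUniqueness, Literature.Barriers.QuantumFields.FixedCouplingUltralocality, ChatterjeeYMProb2019, Chatterjee2026YMHiggs
[crux] (existence leg, RE-TYPED for the 2026-08-16 Statement) for every compact simple Lie group G:
IF for every faithful unitary r the volume-uniform weak-coupling lattice gap holds
(UniformLatticeGap body for G, Borel σ-algebra), THEN there are r, a sequential scheme sch WITH β_k
→ ∞ (`sch.HasWeakCouplingLimit`) and OS data T with IsYangMillsFor r sch T, T non-trivial and
non-Gaussian in tr F², and Δ > 0 with T.HasMassGap Δ ∧ HasLatticeMassGap r sch Δ. Intended use: a_k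
∝ m(β_k) with β_k → ∞ (ξ(β) → ∞ is 2001-refereed and hub-filed: DirichletWindow /
XiCompleteMonotonicity), joint continuum limit with E0–E4 at that scale (Bałaban UV control, E1 by
any of the hub's rotation routes), non-triviality from the curvature three/four-point function.
[deps: UniformLatticeGap] [difficulty: open-problem] -/
@[route_item "route-QuantumFields-ConvexGribovBody"]
def ContinuumLegGivenGap : Prop :=
  ∀ (G : Type) [Group G] [TopologicalSpace G] [IsTopologicalGroup G] [CompactSpace G], Literature.MathematicalPhysics.QuantumFieldTheory.IsCompactSimpleLieGroup G → letI : MeasurableSpace G := borel G; haveI : BorelSpace G := ⟨rfl⟩; (∀ r : Literature.MathematicalPhysics.QuantumFieldTheory.LatticeRep G, ∃ β₀ : ℝ, ∀ β : ℝ, β₀ ≤ β → ∃ m : ℝ, 0 < m ∧ ∃ S₁ : ℕ, ∀ A B : Literature.MathematicalPhysics.QuantumFieldTheory.YMSpecies G, ∃ C : ℝ, ∀ S n : ℕ, S₁ ≤ S → n ≤ S → |Literature.MathematicalPhysics.QuantumFieldTheory.latticeConnectedCorr r.ρ β (2 * S + 1) A.F B.F n| ≤ C * Real.exp (-(m * n)))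 → ∃ (r : Literature.MathematicalPhysics.QuantumFieldTheory.LatticeRep G) (sch : Literature.MathematicalPhysics.QuantumFieldTheory.SpeciesScheme (Literature.MathematicalPhysics.QuantumFieldTheory.YMSpecies G)) (T : Literature.MathematicalPhysics.QuantumFieldTheory.OSData (Literature.MathematicalPhysics.QuantumFieldTheory.YMSpecies G) 4), sch.HasWeakCouplingLimit ∧ Literature.MathematicalPhysics.QuantumFieldTheory.IsYangMillsFor r sch T ∧ T.IsNontrivial r.curvature ∧ T.IsNonGaussian r.curvature ∧ ∃ Δ > 0, T.HasMassGap Δ ∧ Literature.MathematicalPhysics.QuantumFieldTheory.HasLatticeMassGap r sch Δ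

/-- item stmt-QuantumFields-16405 · crux · rank 6 · open · by planner
why it might fail: It is the target for SO(3)-type groups: local observables must cluster volume-uniformly across |H²(T³;π₁G)| light near-degenerate flux vacua (sector-blindness at rate ≥ m) on top of the weak-coupling gap itself; nothing rigorous beyond strong coupling; bulk transitions sit at bounded β.
sources: tHooft1979Flux, DeforcrandJahn2003, ForcrandSmekal2002, KovacsTomboulis2000, HallidaySchwimmer1981, BhanotCreutz1981
[crux] (NEW 2026-08-16, route-choice repair; reviewer's repair R2) the UniformLatticeGap body for
compact simple G with ¬SimplyConnectedSpace G (SO(3) = PSU(2), PSU(N), SO(N ≥ 3), SU(4)/ℤ₂,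
Sp(N)/ℤ₂, E₆/ℤ₃, E₇/ℤ₂, …) and every faithful unitary r: there is β₀ with, for all β ≥ β₀, m > 0 and
S₁ such that all pairs of gauge-invariant local observables A, B satisfy |⟨A·τ_n B⟩ − ⟨A⟩⟨B⟩| ≤
C_{A,B} e^{−m n} on every torus (2S+1)⁴, S ≥ S₁, n ≤ S, under Wilson's measure at coupling β. These
are exactly the groups where the route's slice-Poincaré mechanism provably cannot work
(poincareHypothesis_unsatisfiable_of_sliceBottleneckAt, modulo the light magnetic-flux sectors m ∈
H²(T³; π₁G): tHooft1979Flux; Z₋/Z₊ → 1, Greensite2011 §4.4; DeforcrandJahn2003 §§4–6). Natural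
mechanism (not typed yet): the periodic (G, r)-theory is the (G̃, r∘π)-theory, a mixture over
|H²(T³; π₁G)| flux sectors up to a dilute gas of π₁-monopoles of action ≥ c₀β per unit length;
per-sector gap (e.g. a sector-conditioned Poincaré inequality E Var(f | m) ≤ C·Dmax·dir f,
reviewer's R1) + sector-blindness of local observables at rate ≥ m (flux energies ~ e^{−ρS²} in the
confined phase) ⇒ the clustering bound. closes uses -/
@[route_item "route-QuantumFields-ConvexGribovBody"]
def NonSimplyConnectedLatticeGap : Prop :=
  ∀ (G : Type) [Group G] [TopologicalSpace G] [IsTopologicalGroup G] [CompactSpace G] [MeasurableSpace G] [BorelSpace G], Literature.MathematicalPhysics.QuantumFieldTheory.IsCompactSimpleLieGroup G → ¬ SimplyConnectedSpace G → ∀ r : Literature.MathematicalPhysics.QuantumFieldTheory.LatticeRep G, ∃ β₀ : ℝ, ∀ β : ℝ, β₀ ≤ β → ∃ m : ℝ, 0 < m ∧ ∃ S₁ : ℕ, ∀ A B : Literature.MathematicalPhysics.QuantumFieldTheory.YMSpecies G, ∃ C : ℝ, ∀ S n : ℕ, S₁ ≤ S → n ≤ S → |Literature.MathematicalPhysics.QuantumFieldTheory.latticeConnectedCorr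 r.ρ β (2 * S + 1) A.F B.F n| ≤ C * Real.exp (-(m * n))

/-- item stmt-QuantumFields-8779 · support · rank 2 · open · by planner
why it might fail: Brascamp–Lieb needs Hess(−log π) ≥ c·D⁻¹ on all of the lattice FMR, which is not flat-convex (compact links, magnetic term non-convex at |A|~1, copies inside Λ); a β-uniform C forces m_glueball ≳ M_Gribov/(C·N) for all β ≥ β₀ — unproved; one soft gauge-invariant mode with Var/dir ≫ Nξ/β kills it.
sources: BrascampLieb1976, Caffarelli2000, arXiv:1006.1686, Zwanziger1994, DellantonioZwanziger1991, Zwanziger1982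
[crux] (card K1, stated as its Brascamp–Lieb OUTPUT) there are C = C(G, r) > 0 and β₀ such that for
β ≥ β₀ and all large tori (S ≥ S₀(β)): for every gauge-invariant function f of the time-zero spatial
links, Lipschitz in the link matrices, Var_μ(f) ≤ C · Dmax(β, S) · Σ_{ℓ spatial, t=0} ∫ |∇_ℓ f|² dμ,
where |∇_ℓ f| is the metric slope in link ℓ (Frobenius metric pulled back by r.ρ), μ is Wilson's
measure on (2S+1)⁴ and Dmax = sup over spatial momenta p of the equal-time transverse gluon
covariance D(p) = (2S+1)⁻³ E ‖Σ_y e^{−2πi p·y/(2S+1)} A_j(y)‖²_F of the minimal-Coulomb-gauge field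
A = anti-Hermitian part of r.ρ(U^h), h an absolute minimiser of the slice Coulomb functional (sup
over minimisers inside the integral). Intended proof: on the fundamental modular region the vacuum
law is log-concave relative to the Gaussian of covariance D (horizon Jacobian = convexifier), and
Brascamp–Lieb / Caffarelli give the Poincaré constant ‖D‖_op with a dimension-free constant.
[difficulty: open-problem] -/
@[route_item "route-QuantumFields-ConvexGribovBody"]
def BrascampLiebVacuum : Prop :=
  ∀ (G : Type) [Group G] [TopologicalSpace G] [IsTopologicalGroup G] [CompactSpace G] [MeasurableSpace G] [BorelSpace G], Literature.MathematicalPhysics.QuantumFieldTheory.IsCompactSimpleLieGroup G → ∀ r : Literature.MathematicalPhysics.QuantumFieldTheory.LatticeRep G, ∃ C : ℝ, 0 < C ∧ ∃ β₀ : ℝ, ∀ β : ℝ, β₀ ≤ β → ∃ S₀ : ℕ, ∀ S : ℕ, S₀ ≤ S → let μ := Literature.MathematicalPhysics.QuantumFieldTheory.wilsonMeasure (d := 4) (L := 2 * S + 1) r.ρ β; let fro : Matrix (Fin r.N) (Fin r.N) ℂ → ℝ := fun M => ∑ a, ∑ b, ‖M a b‖ ^ 2; let coul : Literature.MathematicalPhysics.QuantumFieldTheory.GaugeConfig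 4 (2 * S + 1) G → (Literature.MathematicalPhysics.QuantumFieldTheory.Site 4 (2 * S + 1) → G) → ℝ := fun U h => -∑ e : Literature.MathematicalPhysics.QuantumFieldTheory.Edge 4 (2 * S + 1), (if e.1 0 = 0 ∧ e.2 ≠ 0 then (r.ρ (Literature.MathematicalPhysics.QuantumFieldTheory.gaugeTransform h U e)).trace.re else 0); let cov : Literature.MathematicalPhysics.QuantumFieldTheory.GaugeConfig 4 (2 * S + 1) G → (Literature.MathematicalPhysics.QuantumFieldTheory.Site 4 (2 * S + 1) → G) → (Fin 3 → ZMod (2 * S + 1)) → ℝ := fun U h p => (∑ j : Fin 3, fro (∑ y : Fin 3 → ZMod (2 * S + 1), Complex.exp (-(2 * Real.pi * Complex.I * (∑ i : Fin 3, ((p i).val : ℂ) * ((y i).val : ℂ)) / (2 * S + 1 : ℂ))) • ((1 / 2 : ℂ) • (r.ρ (Literature.MathematicalPhysics.QuantumFieldTheory.gaugeTransform h U (Fin.cons (0 : ZMod (2 * S + 1)) y, j.succ)) - (r.ρ (Literature.MathematicalPhysics.QuantumFieldTheory.gaugeTransform h U (Fin.cons (0 : ZMod (2 * S + 1)) y,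 j.succ)))ᴴ)))) / ((2 * S + 1 : ℝ) ^ 3); let Dmax : ℝ := ⨆ p : Fin 3 → ZMod (2 * S + 1), ∫ U, (⨆ h : {h : Literature.MathematicalPhysics.QuantumFieldTheory.Site 4 (2 * S + 1) → G // ∀ h', coul U h ≤ coul U h'}, cov U h.1 p) ∂μ; let slope : (Literature.MathematicalPhysics.QuantumFieldTheory.GaugeConfig 4 (2 * S + 1) G → ℝ) → Literature.MathematicalPhysics.QuantumFieldTheory.GaugeConfig 4 (2 * S + 1) G → Literature.MathematicalPhysics.QuantumFieldTheory.Edge 4 (2 * S + 1) → ℝ := fun f U e => Filter.limsup (fun g : G => |f (Function.update U e g) - f U| / Real.sqrt (fro (r.ρ g - r.ρ (U e)))) (𝓝[≠] (U e)); let dir : (Literature.MathematicalPhysics.QuantumFieldTheory.GaugeConfig 4 (2 * S + 1) G → ℝ) → ℝ := fun f => ∑ e : Literature.MathematicalPhysics.QuantumFieldTheory.Edge 4 (2 * S + 1), (if e.1 0 = 0 ∧ e.2 ≠ 0 then ∫ U, (slope f U e) ^ 2 ∂μ else 0); ∀ f : Literature.MathematicalPhysics.QuantumFieldTheory.GaugeConfig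 4 (2 * S + 1) G → ℝ, Literature.MathematicalPhysics.QuantumFieldTheory.IsGaugeInvariant f → (∀ U V : Literature.MathematicalPhysics.QuantumFieldTheory.GaugeConfig 4 (2 * S + 1) G, (∀ e : Literature.MathematicalPhysics.QuantumFieldTheory.Edge 4 (2 * S + 1), e.1 0 = 0 → e.2 ≠ 0 → U e = V e) → f U = f V) → (∃ K : ℝ, ∀ U V : Literature.MathematicalPhysics.QuantumFieldTheory.GaugeConfig 4 (2 * S + 1) G, |f U - f V| ≤ K * ∑ e, Real.sqrt (fro (r.ρ (U e) - r.ρ (V e)))) → ∫ U, (f U - ∫ V, f V ∂μ) ^ 2 ∂μ ≤ C * Dmax * dir f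

/-- item stmt-QuantumFields-8783 · support · rank 9 · closed · proved by Summit.QuantumFields.YangMills.Theorems.strongCouplingShape_proof @ 63c9f061e3b0 (prover) · by planner
sources: OsterwalderSeilerAnnPhys1978, Seiler1982
[support] calibration of the target's SHAPE in the one regime where it is known: for every compact
simple G and r there is β₁ > 0 such that for 0 ≤ β < β₁ the UniformLatticeGap body holds
(volume-uniform time clustering of all pairs of gauge-invariant local observables on all large tori,
n ≤ S) — Osterwalder–Seiler's cluster expansion, in the tree as the PROVED facts
osterwalder_seiler_torusClustering / osterwalder_seiler_strongCoupling_secondCountable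
(StatMech-shaped); this item re-renders them in the latticeConnectedCorr shape (second countability
of G follows from the faithful representation r). [difficulty: M] -/
@[route_item "route-QuantumFields-ConvexGribovBody"]
def StrongCouplingShape : Prop :=
  ∀ (G : Type) [Group G] [TopologicalSpace G] [IsTopologicalGroup G] [CompactSpace G] [MeasurableSpace G] [BorelSpace G], Literature.MathematicalPhysics.QuantumFieldTheory.IsCompactSimpleLieGroup G → ∀ r : Literature.MathematicalPhysics.QuantumFieldTheory.LatticeRep G, ∃ β₁ : ℝ, 0 < β₁ ∧ ∀ β : ℝ, 0 ≤ β → β < β₁ → ∃ m : ℝ, 0 < m ∧ ∃ S₁ : ℕ, ∀ A B : Literature.MathematicalPhysics.QuantumFieldTheory.YMSpecies G, ∃ C : ℝ, ∀ S n : ℕ, S₁ ≤ S → n ≤ S → |Literature.MathematicalPhysics.QuantumFieldTheory.latticeConnectedCorr r.ρ β (2 * S + 1) A.F B.F n| ≤ C * Real.exp (-(m * n))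

-- `StrongCouplingShape` holds: proved by `Summit.QuantumFields.YangMills.Theorems.strongCouplingShape_proof` @ 63c9f061e3b0 (its module imports this route file, so no `_holds` link can be stated here).

/-- item stmt-QuantumFields-8784 · assembly · rank 1 · closed · proved by Summit.QuantumFields.YangMills.Theorems.convexGribovBody_assembly_proof @ 73afd7aeac46 (prover) · by planner
sources: JaffeWitten2000, OsterwalderSeilerAnnPhys1978
[assembly] BrascampLiebVacuum → CovarianceBound → PoincareToGap → ContinuumLegGivenGap → YangMills
(the conjunct; root-namespace constant of Summits/QuantumFields/YangMills/Statement.lean). -/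
@[route_item "route-QuantumFields-ConvexGribovBody"]
def Assembly : Prop :=
  BrascampLiebVacuum → CovarianceBound → PoincareToGap → ContinuumLegGivenGap → YangMills

-- `Assembly` holds: proved by `Summit.QuantumFields.YangMills.Theorems.convexGribovBody_assembly_proof` @ 73afd7aeac46 (its module imports this route file, so no `_holds` link can be stated here).

/-! D-0027 §2.1 — DECIDING THEOREM (planner-authored via `route open/edit --closes-file`; by planner-rchoice-QuantumFields-ConvexGribovBody-b65eaaed-0 2026-08-16T18:49:41Z):
its hypotheses are this route's items and its conclusion the sub-problem Statement (glue_lint), and it elaborates with this file. -/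

/-- ROUTE GLUE (D-0019 assembly / D-0027 §2.1), PURE LOGIC: the listed items imply the sub-problem
statement `YangMills` (route-choice repair 2026-08-16, rev 5: the functional-inequality leg is cut
along `π₁(G)`). Fix a compact simple `G` with its Borel σ-algebra; `ContinuumLegGivenGap` (the
existence leg, weak-coupling scheme `β_k → ∞`) reduces `YangMills` for `G` to the volume-uniform
weak-coupling lattice gap for every faithful unitary `r`. If `G` is simply connected:
`BrascampLiebVacuumSC` gives `β₁` and, per `β ≥ β₁`, `C > 0` and `S₀`; `CovarianceBound` gives `β₂`
and, per `β ≥ β₂`, `D > 0` with `∫ sup_h cov ≤ D` at every momentum and `S₀'`; for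
`β ≥ max (max β₁ β₂) 1` (so `β > 0`) and every torus with `S ≥ max S₀ S₀'`, every admissible test
function satisfies `Var f ≤ C · Dmax · dir f ≤ (C · D) · dir f` (`Dmax = ⨆ₚ ∫ … ≤ D` by `ciSup_le`,
`0 ≤ dir f` as a finite sum of integrals of squares), so the Poincaré hypothesis of `PoincareToGap`
holds with `κ = C · D` and returns the clustering body. If `G` is not simply connected:
`NonSimplyConnectedLatticeGap` is the clustering body. `UniformLatticeGap` (target),
`StrongCouplingShape` (support), the superseded `BrascampLiebVacuum` (held support) and `Assembly`
are not hypotheses. Axioms: propext, Classical.choice, Quot.sound. -/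
@[closes "route-QuantumFields-ConvexGribovBody"] theorem closes (h₁ : BrascampLiebVacuumSC) (h₂ : CovarianceBound) (h₃ : PoincareToGap)
    (h₄ : NonSimplyConnectedLatticeGap) (h₅ : ContinuumLegGivenGap) : YangMills := by
  intro G _ _ _ _ hG
  letI : MeasurableSpace G := borel G
  haveI : BorelSpace G := ⟨rfl⟩
  refine h₅ G hG fun r => ?_
  by_cases hSC : SimplyConnectedSpace G
  · obtain ⟨β₁, hBL⟩ := h₁ G hG hSC r
    obtain ⟨β₂, hCB⟩ := h₂ G hG r
    refine ⟨max (max β₁ β₂) 1, fun β hβ => ?_⟩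
    have hβ₁ : β₁ ≤ β := le_trans (le_trans (le_max_left _ _) (le_max_left _ _)) hβ
    have hβ₂ : β₂ ≤ β := le_trans (le_trans (le_max_right _ _) (le_max_left _ _)) hβ
    have hβ0 : 0 < β := lt_of_lt_of_le one_pos (le_trans (le_max_right _ _) hβ)
    obtain ⟨C, hC, S₀, hS₀⟩ := hBL β hβ₁
    obtain ⟨D, hD, S₀', hS₀'⟩ := hCB β hβ₂
    refine h₃ G hG r β hβ0 (C * D) (mul_pos hC hD) (max S₀ S₀') fun S hS => ?_
    intro μ fro slope dir f hf₁ hf₂ hf₃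
    have hA := hS₀ S (le_trans (le_max_left _ _) hS) f hf₁ hf₂ hf₃
    have hB := hS₀' S (le_trans (le_max_right _ _) hS)
    have hdir : 0 ≤ dir f := by
      refine Finset.sum_nonneg fun e _ => ?_
      split_ifs
      · exact integral_nonneg fun U => sq_nonneg _
      · exact le_rfl
    refine le_trans hA ?_
    exact mul_le_mul_of_nonneg_right (mul_le_mul_of_nonneg_left (ciSup_le fun p => hB p) hC.le) hdir
  · exact h₄ G hG hSC r

end Summit.QuantumFields.YangMills.Theses.ConvexGribovBody
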